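import Summits.QuantumFields.YangMills.Theorems.ColdStartUniversalityShenZhuZhuFiniteVolumeErgodicityW1SU2
import Summits.QuantumFields.YangMills.Theorems.ColdStartUniversalityLatticeLangevinKuwadaDuality
import Summits.QuantumFields.YangMills.Theorems.ColdStartUniversalityLatticeLangevinLocalGradientBound
import Summits.QuantumFields.YangMills.Theorems.ColdStartUniversalityLatticeLangevinStrongFeller
import Summits.QuantumFields.YangMills.Theorems.ColdStartUniversalityLatticeLangevinRiemannLocalToGlobal
import Literature.MeasureTheory.OptimalTransport.KantorovichDuality
import HarnessLib

/-!
# SHEN–ZHU–ZHU'S THEOREM 4.2 (4.5) AS PRINTED — THE `W₂` CONTRACTION — for the `SU(2)` lattice Langevin dynamics on `(ℤ/L)³`: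
# `W₂^{ρ_L}(δ_Q P_t, δ_{Q'} P_t) ≤ e^(−(1−12|β'|)t)·ρ_L(Q,Q')` for `|β'| < 1/12`, uniformly in `L`, and the named fact
# `shenZhuZhu_finiteVolumeErgodicity (fundamentalLatticeRep 2) 3` VERBATIM (printed hypotheses `K_𝒮 > 0`, printed rate `e^(−K_𝒮 t)`, cost `ρ_L²`)

Seat `ym-line-csu-p1` (g42), route `ColdStartUniversality` of `Summits/QuantumFields/YangMills`, helper file G65 (`--supports stmt-QuantumFields-24809`).
Kuwada's duality (Bakry–Gentil–Ledoux Prop. 9.7.1 / Thm. 9.7.2: the pointwise `L²` gradient bound `|∇P_t f|² ≤ e^{−2Kt}P_t|∇f|²` is equivalent to the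
`W₂` contraction `W₂(δ_x P_t, δ_y P_t) ≤ e^{−Kt} d(x,y)`), carried out in the tree for the `SU(2)` SZZ dynamics: the abstract argument is G64a/G64b
(`kuwada_duality_pairs`: Hopf–Lax flow along a geodesic, G62), its two analytic inputs are G63c (the `(G₂)` bound for Lipschitz observables with local
data, from g29's `wilson_carre_transition_le_uniform`) and G61 (strong Feller), the geometric input is the constant-speed product geodesic of G51, and
the primal (coupling) statement follows from the tree's Kantorovich duality for the continuous cost `ρ_L²` on the compact metric space `(SU(2)^E, ρ_L)`.

* ★ `exists_constSpeed_geodesic_two` — for all `Q, Q'` a path `γ` with `γ 0 = Q`, `γ 1 = Q'`, `ρ_L(γ_s, γ_(s')) = |s − s'|·ρ_L(Q,Q')` on `[0,1]`;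
* ★★★ `wilson_kuwada_pairs` — `t > 0`: `∫φ dκ_t(x) + ∫ψ dκ_t(y) ≤ e^(−2(1−12|β'|)t)·ρ_L(x,y)²` for all continuous `φ ⊕ ψ ≤ ρ_L²`;
* ★★★★ `wilson_szzWasserstein_W2_contraction` — `t > 0`: `szzWassersteinSq ρ_L² (κ_t(Q,·)) (κ_t(Q',·)) ≤ ofReal(e^(−2(1−12|β'|)t)·ρ_L(Q,Q')²)`, i.e. an
  OPTIMAL COUPLING with `E ρ_L(U_t,U'_t)² ≤ e^(−2(1−12|β'|)t) ρ_L(Q,Q')²` — `W₂ ≤ e^(−(1−12|β'|)t) ρ_L`;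
* ★★★★ **`szzDiracContraction_W2_su2`** — `SZZDiracContraction (fundamentalLatticeRep 2) 3 L β' (1 − 12|β'|) (torusRiemannDistSq (fundamentalLatticeRep 2))`
  for every `L`, `|β'| < 1/12`: SZZ (4.5) EXACTLY in the Literature's conclusion shape, for ANY two strong solutions on ANY filtered probability spaces;
* ★★★★ `szzDiracContraction_W2_su2_printedRate` — the same at `β' = 2β` with the printed constant `K_𝒮 = szzBakryEmeryConstSU 2 3 β` (`= 1 − 32|β| ≤ 1 − 12|β'|`);
* ★★★★★ **`shenZhuZhu_finiteVolumeErgodicity_su2 : shenZhuZhu_finiteVolumeErgodicity (fundamentalLatticeRep 2) 3`** — the NAMED FACT (SZZ Theorem 4.2 (1)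
  with its "in particular": `W₂` Dirac contraction at rate `K_𝒮` AND uniqueness of the invariant measure, `SU` conjunct; `SO` conjunct vacuous) is now a
  THEOREM of the tree for `SU(2)`, `d = 3`.

THEOREMS ONLY, no definition (the metric structure `ρ_L` is a `letI` inside the proofs), no sorry.  HONEST FRAMING: fixed cut-off, finite volume,
`|β'| < 1/12` (high temperature); the discharge is for the instance `(SU(2), d = 3)` of the named fact, not for general `SU(N)`/`SO(N)`/`d`; nothing
`K`-uniform along the route's scaling `β'_K → ∞`; `UniformColdStartMixing` (24809, ASIDE) is not restated; no crux, rung or summit statement is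
proved; the Yang–Mills mass gap is NOT proved.
-/

set_option autoImplicit false

noncomputable section

namespace Summit.QuantumFields.YangMills.Theorems.ColdStartUniversality

open MeasureTheory ProbabilityTheory Matrix Complex Finset Filter Topology Set Metric
open scoped BigOperators NNReal ENNReal
open Literature.MathematicalPhysics.QuantumFieldTheory
open Literature.MathematicalPhysics.QuantumLattice (fundamentalRep fundamentalLatticeRep continuous_fundamentalRep fundamentalRep_apply fundamentalLatticeRep_N)

variable {L : ℕ} [NeZero L]

/-! ## §1. Constant-speed geodesics of `ρ_L` (G51) -/

/-- ★ **Geodesic interpolation in `(SU(2)^E, ρ_L)`**: for all `Q, Q'` there is a path `γ : ℝ → SU(2)^E` with `γ 0 = Q`, `γ 1 = Q'` and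
`ρ_L(γ_s, γ_(s')) = |s − s'|·ρ_L(Q,Q')` for `s, s' ∈ [0,1]` (the product flow of the minimal logarithms, G40/G51). [cite: GallotHulinLafontaine2004, 2.91] -/
theorem exists_constSpeed_geodesic_two (Q Q' : GaugeConfig 3 L (Matrix.specialUnitaryGroup (Fin 2) ℂ)) :
    ∃ γ : ℝ → GaugeConfig 3 L (Matrix.specialUnitaryGroup (Fin 2) ℂ), γ 0 = Q ∧ γ 1 = Q' ∧
      ∀ s ∈ Set.Icc (0 : ℝ) 1, ∀ s' ∈ Set.Icc (0 : ℝ) 1,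
        Real.sqrt (torusRiemannDistSq (fundamentalLatticeRep 2) (γ s) (γ s')) = |s - s'| * Real.sqrt (torusRiemannDistSq (fundamentalLatticeRep 2) Q Q') := by
  classical
  have hlog : ∀ e : Edge 3 L, ∃ X : Matrix (Fin 2) (Fin 2) ℂ, X ∈ (fundamentalLatticeRep 2).lieAlg ∧
      NormedSpace.exp X * (Q e : Matrix (Fin 2) (Fin 2) ℂ) = (Q' e : Matrix (Fin 2) (Fin 2) ℂ) ∧
      Real.sqrt (hsForm 2 X X) = (fundamentalLatticeRep 2).riemannDist (Q e) (Q' e) := fun e =>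
    exists_mem_lieAlg_exp_mul_eq_sqrt_hsForm_eq_riemannDist (Q e) (Q' e)
  choose X hXmem hXexp hXnorm using hlog
  have hXh : ∀ e, (X e)ᴴ = -(X e) := fun e => by
    rw [← Matrix.star_eq_conjTranspose]; exact (fundamentalLatticeRep 2).star_eq_neg_of_mem_lieAlg (hXmem e)
  have hX0 : ∀ e, (X e).trace = 0 := fun e => trace_eq_zero_of_mem_lieAlg_two (hXmem e)
  have hXle : ∀ e, Real.sqrt (hsForm 2 (X e) (X e)) ≤ Real.sqrt 2 * Real.pi := fun e => by
    rw [hXnorm e]; exact riemannDist_two_le _ _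
  have hDX : Real.sqrt (∑ e : Edge 3 L, hsForm 2 (X e) (X e)) = Real.sqrt (torusRiemannDistSq (fundamentalLatticeRep 2) Q Q') := by
    unfold torusRiemannDistSq; congr 1
    exact Finset.sum_congr rfl fun e _ => by rw [← hXnorm e, Real.sq_sqrt (hsForm_self_nonneg _)]
  refine ⟨fun s e => SUNBakryEmery.expSU (N := 2) (Y := Matrix.of fun i j : Fin 2 => X e i j) (hXh e) (hX0 e) s * Q e, ?_, ?_, fun s hs s' hs' => ?_⟩
  · funext e; apply Subtype.ext
    change NormedSpace.exp ((0 : ℝ) • X e) * (Q e : Matrix (Fin 2) (Fin 2) ℂ) = (Q e : Matrix (Fin 2) (Fin 2) ℂ)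
    rw [zero_smul, NormedSpace.exp_zero, Matrix.one_mul]
  · funext e; apply Subtype.ext
    change NormedSpace.exp ((1 : ℝ) • X e) * (Q e : Matrix (Fin 2) (Fin 2) ℂ) = (Q' e : Matrix (Fin 2) (Fin 2) ℂ)
    rw [one_smul, hXexp e]
  · rw [← hDX]; exact sqrt_torusRiemannDistSq_prodFlow_eq Q X hXmem hXh hX0 hXle hs hs'

/-! ## §2. Kuwada's duality for the `SU(2)` lattice Langevin kernel: the Kantorovich-pair form -/

/-- ★★★ **Kuwada's duality for the SZZ semigroup, dual form.**  For `|β'| < 1/12`, `t > 0`, every realising kernel family `κ` and all continuous `φ, ψ`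
with `φ(u) + ψ(v) ≤ ρ_L(u,v)²`:  `∫φ dκ_t(x) + ∫ψ dκ_t(y) ≤ e^(−2(1−12|β'|)t)·ρ_L(x,y)²` (G64b with `a = e^(−(1−12|β'|)t)` from G63c, `b = C_t` from G61,
geodesics from §1). [cite: BakryGentilLedoux2014, Thm 9.7.2] [cite: ShenZhuZhu2022, Theorem 4.2 (4.5)] -/
theorem wilson_kuwada_pairs (L : ℕ) [NeZero L] (β' : ℝ) (hβ : |β'| < 1 / 12)
    (κ : ℝ≥0 → Kernel (GaugeConfig 3 L (Matrix.specialUnitaryGroup (Fin 2) ℂ))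
      (GaugeConfig 3 L (Matrix.specialUnitaryGroup (Fin 2) ℂ))) [∀ t, IsMarkovKernel (κ t)]
    (hreal : ∀ (t : ℝ≥0) (x : GaugeConfig 3 L (Matrix.specialUnitaryGroup (Fin 2) ℂ))
        (Ω : Type) [MeasurableSpace Ω] (P : Measure Ω) [IsProbabilityMeasure P]
        (W : ℝ≥0 → Ω → (Edge 3 L × NoiseIdx 2 → ℝ)) (hW : IsFlatBrownian W P)
        (U : ℝ≥0 → Ω → GaugeConfig 3 L (Matrix.specialUnitaryGroup (Fin 2) ℂ)),
        (∀ ω, U 0 ω = x) →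
        (latticeLangevinDynamics (fundamentalLatticeRep 2) β').IsSolution (fundamentalRep (Fin 2))
          hW.natFiltration P W U →
        κ t x = P.map (U t))
    {t : ℝ≥0} (ht : 0 < (t : ℝ)) {φ ψ : GaugeConfig 3 L (Matrix.specialUnitaryGroup (Fin 2) ℂ) → ℝ} (hφ : Continuous φ) (hψ : Continuous ψ)
    (h : ∀ u v, φ u + ψ v ≤ torusRiemannDistSq (fundamentalLatticeRep 2) u v) (x y : GaugeConfig 3 L (Matrix.specialUnitaryGroup (Fin 2) ℂ)) :
    ∫ w, φ w ∂(κ t x) + ∫ w, ψ w ∂(κ t y) ≤ Real.exp (-(2 * (1 - 12 * |β'|) * (t : ℝ))) * torusRiemannDistSq (fundamentalLatticeRep 2) x y := by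
  classical
  haveI := secondCountableTopology_su2
  haveI := borelSpace_config L
  have hnn : ∀ u v : GaugeConfig 3 L (Matrix.specialUnitaryGroup (Fin 2) ℂ), 0 ≤ torusRiemannDistSq (fundamentalLatticeRep 2) u v := fun u v => by
    unfold torusRiemannDistSq; exact Finset.sum_nonneg fun _ _ => sq_nonneg _
  have hzero : ∀ u v : GaugeConfig 3 L (Matrix.specialUnitaryGroup (Fin 2) ℂ), Real.sqrt (torusRiemannDistSq (fundamentalLatticeRep 2) u v) = 0 ↔ u = v := fun u v => by
    rw [Real.sqrt_eq_zero (hnn u v), torusRiemannDistSq_two_eq_zero_iff]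
  have hself : ∀ u : GaugeConfig 3 L (Matrix.specialUnitaryGroup (Fin 2) ℂ), Real.sqrt (torusRiemannDistSq (fundamentalLatticeRep 2) u u) = 0 := fun u => (hzero u u).2 rfl
  have hcomm : ∀ u v : GaugeConfig 3 L (Matrix.specialUnitaryGroup (Fin 2) ℂ), Real.sqrt (torusRiemannDistSq (fundamentalLatticeRep 2) u v) = Real.sqrt (torusRiemannDistSq (fundamentalLatticeRep 2) v u) :=
    fun u v => by rw [torusRiemannDistSq_two_comm]
  have htri : ∀ u v w : GaugeConfig 3 L (Matrix.specialUnitaryGroup (Fin 2) ℂ), Real.sqrt (torusRiemannDistSq (fundamentalLatticeRep 2) u w) ≤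
      Real.sqrt (torusRiemannDistSq (fundamentalLatticeRep 2) u v) + Real.sqrt (torusRiemannDistSq (fundamentalLatticeRep 2) v w) :=
    fun u v w => sqrt_torusRiemannDistSq_two_triangle u v w
  letI : MetricSpace (GaugeConfig 3 L (Matrix.specialUnitaryGroup (Fin 2) ℂ)) :=
    { __ := PseudoMetricSpace.ofDistTopology (fun u v : GaugeConfig 3 L (Matrix.specialUnitaryGroup (Fin 2) ℂ) => Real.sqrt (torusRiemannDistSq (fundamentalLatticeRep 2) u v))
        hself hcomm htri isOpen_iff_riemannDist_ball,
      eq_of_dist_eq_zero := fun {u v} huv => (hzero u v).1 huv }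
  -- the three hypotheses of the abstract duality
  have ha : 0 ≤ Real.exp (-((1 - 12 * |β'|) * (t : ℝ))) := (Real.exp_pos _).le
  have hb : 0 ≤ Real.sqrt ((1 - 12 * |β'|) / (Real.exp (2 * (1 - 12 * |β'|) * (t : ℝ)) - 1)) := Real.sqrt_nonneg _
  have hgeo : ∀ u v : GaugeConfig 3 L (Matrix.specialUnitaryGroup (Fin 2) ℂ), ∃ γ : ℝ → GaugeConfig 3 L (Matrix.specialUnitaryGroup (Fin 2) ℂ), γ 0 = v ∧ γ 1 = u ∧
      ∀ s s' : ℝ, s ∈ Set.Icc (0 : ℝ) 1 → s' ∈ Set.Icc (0 : ℝ) 1 → dist (γ s) (γ s') ≤ |s - s'| * dist u v := by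
    intro u v
    obtain ⟨γ, h0, h1, hd⟩ := exists_constSpeed_geodesic_two v u
    refine ⟨γ, h0, h1, fun s s' hs hs' => ?_⟩
    show Real.sqrt (torusRiemannDistSq (fundamentalLatticeRep 2) (γ s) (γ s')) ≤ |s - s'| * Real.sqrt (torusRiemannDistSq (fundamentalLatticeRep 2) u v)
    rw [hd s hs s' hs', torusRiemannDistSq_two_comm v u]
  have h' : ∀ u v : GaugeConfig 3 L (Matrix.specialUnitaryGroup (Fin 2) ℂ), φ u + ψ v ≤ dist u v ^ 2 := fun u v => by
    show φ u + ψ v ≤ Real.sqrt (torusRiemannDistSq (fundamentalLatticeRep 2) u v) ^ 2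
    rw [Real.sq_sqrt (hnn u v)]; exact h u v
  have hmain := kuwada_duality_pairs (κ t) ha hb
    (fun G M hG h0 hM u u' => wilson_strongFeller_upperSemicontinuous L β' hβ κ hreal hG h0 hM ht u u')
    (fun F Lf hLf hlipF R hR G M hGm hG0 hGM hloc u u' S hS => wilson_local_gradient_bound L β' hβ κ hreal hLf hlipF hR hGm hG0 hGM hloc t u u' hS)
    hgeo hφ hψ h' x y
  have hd2 : dist x y ^ 2 = torusRiemannDistSq (fundamentalLatticeRep 2) x y := by
    show Real.sqrt (torusRiemannDistSq (fundamentalLatticeRep 2) x y) ^ 2 = _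
    exact Real.sq_sqrt (hnn x y)
  have he : Real.exp (-((1 - 12 * |β'|) * (t : ℝ))) ^ 2 = Real.exp (-(2 * (1 - 12 * |β'|) * (t : ℝ))) := by
    rw [← Real.exp_nat_mul]; congr 1; push_cast; ring
  rw [hd2, he] at hmain
  exact hmain

/-! ## §3. The optimal coupling: `W₂(κ_t(Q,·), κ_t(Q',·)) ≤ e^(−(1−12|β'|)t)·ρ_L(Q,Q')` -/

/-- ★★★★ **Shen–Zhu–Zhu's (4.5) with an optimal coupling, `W₂` form, at every time `t > 0`.**  For `|β'| < 1/12`, every `L`, every realising kernel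
family `κ` and all `Q, Q'`:  `szzWassersteinSq ρ_L² (κ_t(Q,·)) (κ_t(Q',·)) ≤ ofReal(e^(−2(1−12|β'|)t)·ρ_L(Q,Q')²)` — Kantorovich duality (tree,
Villani Thm. 1.3, continuous cost `ρ_L²` on the compact metric space `(SU(2)^E, ρ_L)`) applied to §2. [cite: ShenZhuZhu2022, Theorem 4.2 (4.5)] [cite: Villani2003, Thm. 1.3] -/
theorem wilson_szzWasserstein_W2_contraction (L : ℕ) [NeZero L] (Q Q' : GaugeConfig 3 L (Matrix.specialUnitaryGroup (Fin 2) ℂ)) (β' : ℝ) (hβ : |β'| < 1 / 12)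
    (κ : ℝ≥0 → Kernel (GaugeConfig 3 L (Matrix.specialUnitaryGroup (Fin 2) ℂ))
      (GaugeConfig 3 L (Matrix.specialUnitaryGroup (Fin 2) ℂ))) [∀ t, IsMarkovKernel (κ t)]
    (hreal : ∀ (t : ℝ≥0) (x : GaugeConfig 3 L (Matrix.specialUnitaryGroup (Fin 2) ℂ))
        (Ω : Type) [MeasurableSpace Ω] (P : Measure Ω) [IsProbabilityMeasure P]
        (W : ℝ≥0 → Ω → (Edge 3 L × NoiseIdx 2 → ℝ)) (hW : IsFlatBrownian W P)
        (U : ℝ≥0 → Ω → GaugeConfig 3 L (Matrix.specialUnitaryGroup (Fin 2) ℂ)),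
        (∀ ω, U 0 ω = x) →
        (latticeLangevinDynamics (fundamentalLatticeRep 2) β').IsSolution (fundamentalRep (Fin 2))
          hW.natFiltration P W U →
        κ t x = P.map (U t))
    {t : ℝ≥0} (ht : 0 < (t : ℝ)) :
    szzWassersteinSq (torusRiemannDistSq (fundamentalLatticeRep 2)) (κ t Q) (κ t Q') ≤
      ENNReal.ofReal (Real.exp (-(2 * (1 - 12 * |β'|) * (t : ℝ))) * torusRiemannDistSq (fundamentalLatticeRep 2) Q Q') := by
  classical
  haveI := secondCountableTopology_su2
  haveI := borelSpace_config L
  have hnn : ∀ u v : GaugeConfig 3 L (Matrix.specialUnitaryGroup (Fin 2) ℂ), 0 ≤ torusRiemannDistSq (fundamentalLatticeRep 2) u v := fun u v => by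
    unfold torusRiemannDistSq; exact Finset.sum_nonneg fun _ _ => sq_nonneg _
  have hzero : ∀ u v : GaugeConfig 3 L (Matrix.specialUnitaryGroup (Fin 2) ℂ), Real.sqrt (torusRiemannDistSq (fundamentalLatticeRep 2) u v) = 0 ↔ u = v := fun u v => by
    rw [Real.sqrt_eq_zero (hnn u v), torusRiemannDistSq_two_eq_zero_iff]
  have hself : ∀ u : GaugeConfig 3 L (Matrix.specialUnitaryGroup (Fin 2) ℂ), Real.sqrt (torusRiemannDistSq (fundamentalLatticeRep 2) u u) = 0 := fun u => (hzero u u).2 rfl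
  have hcomm : ∀ u v : GaugeConfig 3 L (Matrix.specialUnitaryGroup (Fin 2) ℂ), Real.sqrt (torusRiemannDistSq (fundamentalLatticeRep 2) u v) = Real.sqrt (torusRiemannDistSq (fundamentalLatticeRep 2) v u) :=
    fun u v => by rw [torusRiemannDistSq_two_comm]
  have htri : ∀ u v w : GaugeConfig 3 L (Matrix.specialUnitaryGroup (Fin 2) ℂ), Real.sqrt (torusRiemannDistSq (fundamentalLatticeRep 2) u w) ≤
      Real.sqrt (torusRiemannDistSq (fundamentalLatticeRep 2) u v) + Real.sqrt (torusRiemannDistSq (fundamentalLatticeRep 2) v w) :=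
    fun u v w => sqrt_torusRiemannDistSq_two_triangle u v w
  have hcont2 : Continuous fun p : (GaugeConfig 3 L (Matrix.specialUnitaryGroup (Fin 2) ℂ)) × (GaugeConfig 3 L (Matrix.specialUnitaryGroup (Fin 2) ℂ)) =>
      torusRiemannDistSq (fundamentalLatticeRep 2) p.1 p.2 := continuous_torusRiemannDistSq_two
  letI : MetricSpace (GaugeConfig 3 L (Matrix.specialUnitaryGroup (Fin 2) ℂ)) :=
    { __ := PseudoMetricSpace.ofDistTopology (fun u v : GaugeConfig 3 L (Matrix.specialUnitaryGroup (Fin 2) ℂ) => Real.sqrt (torusRiemannDistSq (fundamentalLatticeRep 2) u v))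
        hself hcomm htri isOpen_iff_riemannDist_ball,
      eq_of_dist_eq_zero := fun {u v} huv => (hzero u v).1 huv }
  -- the cost `c = ρ_L²` and Kantorovich duality
  let c : C((GaugeConfig 3 L (Matrix.specialUnitaryGroup (Fin 2) ℂ)) × (GaugeConfig 3 L (Matrix.specialUnitaryGroup (Fin 2) ℂ)), ℝ) :=
    ⟨fun p => torusRiemannDistSq (fundamentalLatticeRep 2) p.1 p.2, hcont2⟩
  obtain ⟨π, hπ, hlub⟩ := Literature.MeasureTheory.OptimalTransport.exists_isCoupling_isLUB_integral (μ := κ t Q) (ν := κ t Q')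
    (by rw [measure_univ, measure_univ]) c
  -- every dual value is at most the bound (§2)
  have hub : Real.exp (-(2 * (1 - 12 * |β'|) * (t : ℝ))) * torusRiemannDistSq (fundamentalLatticeRep 2) Q Q' ∈
      upperBounds (Literature.MeasureTheory.OptimalTransport.dualValues (κ t Q) (κ t Q') c) := by
    rintro r ⟨φ, ψ, hφψ, rfl⟩
    exact wilson_kuwada_pairs L β' hβ κ hreal ht φ.continuous ψ.continuous (fun u v => hφψ u v) Q Q'
  have hcost : ∫ z, c z ∂π ≤ Real.exp (-(2 * (1 - 12 * |β'|) * (t : ℝ))) * torusRiemannDistSq (fundamentalLatticeRep 2) Q Q' := hlub.2 hub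
  -- the plan is a coupling in the sense of `szzWassersteinSq`
  have hprob : IsProbabilityMeasure π := by
    constructor
    have h1 : π.map Prod.fst Set.univ = 1 := by rw [hπ.map_fst]; exact measure_univ
    rwa [Measure.map_apply measurable_fst MeasurableSet.univ, Set.preimage_univ] at h1
  haveI := hprob
  have hπ' : Literature.Geometry.Riemannian.IsCoupling (κ t Q) (κ t Q') π := ⟨hprob, hπ.map_fst, hπ.map_snd⟩
  have hρi : Integrable (fun z : (GaugeConfig 3 L (Matrix.specialUnitaryGroup (Fin 2) ℂ)) × (GaugeConfig 3 L (Matrix.specialUnitaryGroup (Fin 2) ℂ)) =>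
      torusRiemannDistSq (fundamentalLatticeRep 2) z.1 z.2) π :=
    hcont2.integrable_of_hasCompactSupport (HasCompactSupport.of_compactSpace _)
  calc szzWassersteinSq (torusRiemannDistSq (fundamentalLatticeRep 2)) (κ t Q) (κ t Q')
      ≤ ∫⁻ z, ENNReal.ofReal (torusRiemannDistSq (fundamentalLatticeRep 2) z.1 z.2) ∂π := szzWassersteinSq_le _ hπ'
    _ = ENNReal.ofReal (∫ z, torusRiemannDistSq (fundamentalLatticeRep 2) z.1 z.2 ∂π) :=
        (ofReal_integral_eq_lintegral_ofReal hρi (ae_of_all _ fun z => hnn z.1 z.2)).symm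
    _ ≤ ENNReal.ofReal (Real.exp (-(2 * (1 - 12 * |β'|) * (t : ℝ))) * torusRiemannDistSq (fundamentalLatticeRep 2) Q Q') :=
        ENNReal.ofReal_le_ofReal hcost

/-! ## §4. The Literature's conclusion shape and the named fact -/

/-- ★★★★ **Shen–Zhu–Zhu's Theorem 4.2 (4.5), AS PRINTED (`W₂`), in the Literature's conclusion shape.**  For every `L` and `|β'| < 1/12`:
`SZZDiracContraction (fundamentalLatticeRep 2) 3 L β' (1 − 12|β'|) (torusRiemannDistSq (fundamentalLatticeRep 2))` — for ANY two strong solutions of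
the `SU(2)` lattice Langevin SDE on `(ℤ/L)³` started at `Q`, `Q̄` (each on its own filtered probability space) and every `t ≥ 0`, the coupling infimum of
`E ρ_L(U_t,U'_t)²` is at most `e^(−2(1−12|β'|)t)·ρ_L(Q,Q̄)²`, i.e. `W₂^{ρ_L}(δ_Q P_t, δ_Q̄ P_t) ≤ e^(−Kt)ρ_L(Q,Q̄)` with `K = 1 − 12|β'| ≥ K_𝒮 = 1 − 16|β'|`,
uniformly in the volume (`t = 0`: the Dirac coupling). [cite: ShenZhuZhu2022, Theorem 4.2 (4.5)] [cite: BakryGentilLedoux2014, Thm 9.7.2] -/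
theorem szzDiracContraction_W2_su2 (L : ℕ) [NeZero L] (β' : ℝ) (hβ : |β'| < 1 / 12) :
    SZZDiracContraction (fundamentalLatticeRep 2) 3 L β' (1 - 12 * |β'|) (torusRiemannDistSq (fundamentalLatticeRep 2)) := by
  intro Ω _ P _ W hW U Q hU0 hU Ω' _ P' _ W' hW' U' Q' hU'0 hU' t
  classical
  haveI := secondCountableTopology_su2
  haveI := borelSpace_config L
  have hexp : Real.exp (-2 * (1 - 12 * |β'|) * (t : ℝ)) = Real.exp (-(2 * (1 - 12 * |β'|) * (t : ℝ))) := by congr 1; ring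
  rw [hexp]
  rcases eq_or_lt_of_le (show (0 : ℝ) ≤ (t : ℝ) from t.2) with ht | ht
  · -- `t = 0`: both laws are Dirac masses, couple them diagonally
    have ht0 : t = 0 := by exact_mod_cast ht.symm
    subst ht0
    have hUQ : U 0 = fun _ => Q := funext hU0
    have hUQ' : U' 0 = fun _ => Q' := funext hU'0
    rw [hUQ, hUQ', Measure.map_const, Measure.map_const, measure_univ, measure_univ, one_smul, one_smul]
    have hcpl : Literature.Geometry.Riemannian.IsCoupling (Measure.dirac Q) (Measure.dirac Q')
        (Measure.dirac (Q, Q') : Measure ((GaugeConfig 3 L (Matrix.specialUnitaryGroup (Fin 2) ℂ)) × (GaugeConfig 3 L (Matrix.specialUnitaryGroup (Fin 2) ℂ)))) := by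
      refine ⟨inferInstance, ?_, ?_⟩
      · rw [Measure.fst, Measure.map_dirac' measurable_fst]
      · rw [Measure.snd, Measure.map_dirac' measurable_snd]
    have hmeas : Measurable fun z : (GaugeConfig 3 L (Matrix.specialUnitaryGroup (Fin 2) ℂ)) × (GaugeConfig 3 L (Matrix.specialUnitaryGroup (Fin 2) ℂ)) =>
        ENNReal.ofReal (torusRiemannDistSq (fundamentalLatticeRep 2) z.1 z.2) :=
      ENNReal.measurable_ofReal.comp continuous_torusRiemannDistSq_two.measurable
    calc szzWassersteinSq (torusRiemannDistSq (fundamentalLatticeRep 2)) (Measure.dirac Q) (Measure.dirac Q')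
        ≤ ∫⁻ z, ENNReal.ofReal (torusRiemannDistSq (fundamentalLatticeRep 2) z.1 z.2) ∂(Measure.dirac (Q, Q')) := szzWassersteinSq_le _ hcpl
      _ = ENNReal.ofReal (torusRiemannDistSq (fundamentalLatticeRep 2) Q Q') := lintegral_dirac' _ hmeas
      _ = ENNReal.ofReal (Real.exp (-(2 * (1 - 12 * |β'|) * ((0 : ℝ≥0) : ℝ))) * torusRiemannDistSq (fundamentalLatticeRep 2) Q Q') := by
          rw [NNReal.coe_zero, mul_zero, neg_zero, Real.exp_zero, one_mul]
  · obtain ⟨κ, hκ, -, hreal⟩ := exists_transitionKernel L β'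
    haveI := hκ
    rw [← hreal t Q Ω P W hW U hU0 hU, ← hreal t Q' Ω' P' W' hW' U' hU'0 hU']
    exact wilson_szzWasserstein_W2_contraction L Q Q' β' hβ κ hreal ht

/-- ★★★★ **`W₂` Dirac contraction at the PRINTED rate**: for `0 < K_𝒮 = szzBakryEmeryConstSU 2 3 β` (`= 1 − 32|β|`) and every `L`,
`SZZDiracContraction (fundamentalLatticeRep 2) 3 L (2β) K_𝒮 ρ_L²`, i.e. `W₂^{ρ_L}(law U_t, law U'_t) ≤ e^(−K_𝒮 t)·ρ_L(Q,Q̄)` for any two strong solutions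
from `Q`, `Q̄` (§4 at `β' = 2β`, `|β'| < 1/16`, and `1 − 12|β'| ≥ K_𝒮`). [cite: ShenZhuZhu2022, Theorem 4.2 (4.5)] -/
theorem szzDiracContraction_W2_su2_printedRate (L : ℕ) [NeZero L] (β : ℝ) (hK : 0 < szzBakryEmeryConstSU 2 3 β) :
    SZZDiracContraction (fundamentalLatticeRep 2) 3 L (2 * β) (szzBakryEmeryConstSU 2 3 β) (torusRiemannDistSq (fundamentalLatticeRep 2)) := by
  have hKdef : szzBakryEmeryConstSU 2 3 β = 1 - 32 * |β| := by
    unfold szzBakryEmeryConstSU; norm_num; ring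
  have hβ' : |2 * β| < 1 / 12 := by
    rw [abs_mul, abs_two]; rw [hKdef] at hK; linarith
  intro Ω _ P _ W hW U Q hU0 hU Ω' _ P' _ W' hW' U' Q' hU'0 hU' t
  have h := szzDiracContraction_W2_su2 L (2 * β) hβ' Ω P W hW U Q hU0 hU Ω' P' W' hW' U' Q' hU'0 hU' t
  refine h.trans (ENNReal.ofReal_le_ofReal ?_)
  have hnn : 0 ≤ torusRiemannDistSq (fundamentalLatticeRep 2) Q Q' := by
    unfold torusRiemannDistSq; exact Finset.sum_nonneg fun _ _ => sq_nonneg _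
  refine mul_le_mul_of_nonneg_right (Real.exp_le_exp.2 ?_) hnn
  -- `−2(1 − 12|2β|)t ≤ −2K_𝒮 t` since `K_𝒮 = 1 − 32|β| ≤ 1 − 24|β|`
  rw [hKdef, abs_mul, abs_two]
  have ht : 0 ≤ (t : ℝ) := t.2
  nlinarith [abs_nonneg β]

/-- ★★★★★ **THE NAMED FACT `shenZhuZhu_finiteVolumeErgodicity (fundamentalLatticeRep 2) 3` IS A THEOREM.**  Shen–Zhu–Zhu's Theorem 4.2 (1) with its
"in particular" — for `SU(2)` in its fundamental representation on `(ℤ/L)³`, `L > 1`, under the printed Assumption 1.1 `K_𝒮 = szzBakryEmeryConstSU N 3 β > 0`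
(`N = (fundamentalLatticeRep 2).N = 2`): the PRINTED `W₂` contraction (4.5) `W₂^{ρ_L}(δ_Q P_t^L, δ_Q̄ P_t^L) ≤ e^(−K_𝒮 t) ρ_L(Q,Q̄)` (shape `SZZDiracContraction`,
cost `torusRiemannDistSq`) AND the uniqueness of the invariant measure (`SZZUniqueInvariantMeasure`, tree); the `SO` conjunct is vacuous (`K_𝒮(SO(2)) < 0`).
Discharged via Kuwada's duality (Bakry–Gentil–Ledoux Thm. 9.7.2) from the Bakry–Émery gradient bound — the route [Wan06] of the printed proof.
[cite: ShenZhuZhu2022, Theorem 4.2 (4.5)] [cite: BakryGentilLedoux2014, Thm 9.7.2] -/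
theorem shenZhuZhu_finiteVolumeErgodicity_su2 : shenZhuZhu_finiteVolumeErgodicity (fundamentalLatticeRep 2) 3 := by
  intro _
  refine ⟨fun _ β hK L _ _ => ?_, fun _ β hK => ?_⟩
  · have hN : (fundamentalLatticeRep 2).N = 2 := fundamentalLatticeRep_N 2
    have hK2 : 0 < szzBakryEmeryConstSU 2 3 β := by rwa [hN] at hK
    have hcast : ((fundamentalLatticeRep 2).N : ℝ) * β = 2 * β := by rw [hN]; norm_num
    rw [hcast, hN]
    exact ⟨szzDiracContraction_W2_su2_printedRate L β hK2, szzUniqueInvariantMeasure_su2 L (2 * β)⟩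
  · exfalso
    have hN : (fundamentalLatticeRep 2).N = 2 := fundamentalLatticeRep_N 2
    rw [hN] at hK
    unfold szzBakryEmeryConstSO at hK
    norm_num at hK
    nlinarith [abs_nonneg β]

end Summit.QuantumFields.YangMills.Theorems.ColdStartUniversality

end
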